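import Mathlib
import HarnessLib
import Literature.Analysis.FluidPDE.ClassicalSolution
import Literature.Analysis.FluidPDE.VorticityCalculus
import Summits.NavierStokesRegularity.NavierStokesRegularity.Theorems.RungReynoldsOne.Negative.WithoutLerayHopfFalse
import Summits.NavierStokesRegularity.NavierStokesRegularity.Theorems.TypeIConcentration.Negative.LoadBearing

/-!
# Crux `IsobarTomography.BlobRiccatiClosure` (stmt-NavierStokesRegularity-11740), line
# `type-i-apex-liouville` — N1: the crux is false without the finite-energy hypotheses

Helper file (theorems only) `--supports` the item (registered stub `stub_falseWithoutFiniteEnergy`).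
The crux K1 says: a classical solution `(u, p)` of unforced Navier–Stokes on `ℝ³ × [0, T)` which
is Leray–Hopf from a rapidly decaying datum and satisfies the BLOB HYPOTHESIS — there are `κ > 0`,
a threshold `Ω(t)` and `t₀ < T` such that for `t ∈ [t₀, T)` the peak set `{‖ω(t, ·)‖ > Ω(t)}` is
non-empty and on it `κ ‖ω‖² Δp ≤ ∇²p(ω, ω)` — extends smoothly past `T`. This file is the negative
lemma N1 of the line's ideation memo (IDEATION-r2-k4 §2, crux workfile): with the two finite-energy
hypotheses `IsLerayHopfOn T ν 0 (u 0) u` and `HasRapidSpatialDecay (u 0)` deleted, K1 is FALSE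
(`stub_falseWithoutFiniteEnergy`); sharper, deleting `IsLerayHopfOn` ALONE already makes it false
(`n1_falseWithoutLerayHopf`). So every proof of K1 must spend the energy class.

## The witness (infinite energy, irrotational)

The parasitic pressure-driven drift of Koch–Nadirashvili–Seregin–Šverák (Acta Math. 203 (2009),
§1, p. 3, arXiv:0709.3599: `u = b(t)`, `p = −b′(t)·x`), already in the tree as
`RungReynoldsOneNegative.drift (gI 1)`, `driftP (gI 1)`
(`Theorems/RungReynoldsOne/Negative/WithoutLerayHopfFalse.lean`):
`u(t, x) = ((1 − t)^{-1/2} − 1) e₀`, `p(t, x) = −½ (1 − t)^{-3/2} x₀`, at `ν = T = 1`.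

* it is a classical solution on `[0, 1) × ℝ³` for every viscosity (`drift_isClassical`:
  `∂ₜu = b′e₀ = −∇p`, `(u·∇)u = 0`, `Δu = 0`, `div u = 0`);
* it has NO classical extension past `t = 1`, because `‖u(t, 0)‖ = (1 − t)^{-1/2} − 1 → ∞` while an
  extension would be continuous at `(1, 0)` (`drift_not_hasSmoothExtensionPast`);
* it is IRROTATIONAL: every slice is a constant field, so `curl (u t) ≡ 0` (`n1_curl_drift`); hence
  the blob clause holds trivially with `κ = 1`, `Ω ≡ −1`, `t₀ = 0` — every point is a peak point
  (`−1 < 0 = ‖ω‖`), and at `ω = 0` the inequality reads `1 · 0² · Δp ≤ D²p(x)(0, 0) = 0`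
  (`n1_blob_of_curl_eq_zero`, `n1_blob_drift`);
* it has INFINITE ENERGY: its slices for `0 < t < 1` are non-zero constant fields, not in `L²(ℝ³)`,
  so it is not Leray–Hopf (`not_isLerayHopfOn_driftI`,
  `Theorems/TypeIConcentration/Negative/LoadBearing.lean`), while its datum `u(0) = 0` IS rapidly
  decaying (`drift_rapidDecay`).

So exactly one clause of K1 fails on the witness (`n1_driftI_all_but_lerayHopf`): the Leray–Hopf
(finite-energy) hypothesis is the unique separator between K1 and a false statement, and a fortiori
K1 with both finite-energy clauses deleted is false. (The memo's alternative all-`κ` witnesses, the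
exact linear strain flows `u = (1 − t)⁻¹ L x`, are not needed: the drift is irrotational too.)
-/

noncomputable section

-- the summit and its single sub-problem share the name (CONVENTIONS §1), as in every Theorems file
set_option linter.dupNamespace false

namespace Summit.NavierStokesRegularity.NavierStokesRegularity.Theorems.BlobRiccatiClosure.TypeIApexLiouville

open Literature.Analysis Literature.Analysis.FluidPDE
open Summit.NavierStokesRegularity.NavierStokesRegularity.Theorems.RungReynoldsOneNegative
open Summit.NavierStokesRegularity.NavierStokesRegularity.Theorems.TypeIConcentration.Negative

/-- **The blob clause is trivial for irrotational fields.** If `curl (u t) ≡ 0` for `t ∈ [0, T)`,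
`0 < T`, then the blob hypothesis of K1 holds with `κ = 1`, `Ω ≡ −1`, `t₀ = 0`: the peak set
`{‖ω‖ > −1}` is all of `ℝ³` (witnessed at `x = 0`), and at `ω = 0` both sides of
`κ ‖ω‖² Δp ≤ D²p(x)(ω, ω)` vanish (a continuous multilinear map vanishes as soon as one argument
does, Mathlib `ContinuousMultilinearMap.map_coord_zero`). [folklore] -/
theorem n1_blob_of_curl_eq_zero {T : ℝ} (hT : 0 < T)
    {u : ℝ → EuclideanSpace ℝ (Fin 3) → EuclideanSpace ℝ (Fin 3)}
    (p : ℝ → EuclideanSpace ℝ (Fin 3) → ℝ)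
    (hcurl : ∀ t ∈ Set.Ico 0 T, ∀ x, curl (u t) x = 0) :
    ∃ κ : ℝ, 0 < κ ∧ ∃ Ω : ℝ → ℝ, ∃ t₀ ∈ Set.Ico 0 T, ∀ t ∈ Set.Ico t₀ T,
      (∃ x : EuclideanSpace ℝ (Fin 3), Ω t < ‖curl (u t) x‖) ∧
      ∀ x : EuclideanSpace ℝ (Fin 3), Ω t < ‖curl (u t) x‖ →
        κ * ‖curl (u t) x‖ ^ 2 * Laplacian.laplacian (p t) x ≤
          iteratedFDeriv ℝ 2 (p t) x ![curl (u t) x, curl (u t) x] := by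
  refine ⟨1, one_pos, fun _ => -1, 0, ⟨le_rfl, hT⟩, fun t ht => ⟨⟨0, ?_⟩, fun x _ => ?_⟩⟩
  · rw [hcurl t ht 0, norm_zero]
    norm_num
  · rw [hcurl t ht x, norm_zero]
    have h0 : iteratedFDeriv ℝ 2 (p t) x ![(0 : EuclideanSpace ℝ (Fin 3)), 0] = 0 :=
      (iteratedFDeriv ℝ 2 (p t) x).map_coord_zero 0 (Matrix.cons_val_zero _ _)
    rw [h0]
    norm_num

/-- Every slice of a drift `u(t, ·) = g(t) driftDir` is a constant field, so its vorticity
vanishes identically (`curl` of a field with zero Jacobian is zero). [folklore] -/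
theorem n1_curl_drift (g : ℝ → ℝ) (t : ℝ) (x : EuclideanSpace ℝ (Fin 3)) :
    curl (drift g t) x = 0 := by
  rw [drift_apply]
  exact curl_eq_zero_of_fderiv_eq_zero (fderiv_const_apply _)

/-- **The blob clause of K1 holds for every drift on `[0, 1)`** (`κ = 1`, `Ω ≡ −1`, `t₀ = 0`),
whatever the amplitude `g` and for its own pressure `driftP g`. [folklore] -/
theorem n1_blob_drift (g : ℝ → ℝ) :
    ∃ κ : ℝ, 0 < κ ∧ ∃ Ω : ℝ → ℝ, ∃ t₀ ∈ Set.Ico 0 (1 : ℝ), ∀ t ∈ Set.Ico t₀ 1,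
      (∃ x : EuclideanSpace ℝ (Fin 3), Ω t < ‖curl (drift g t) x‖) ∧
      ∀ x : EuclideanSpace ℝ (Fin 3), Ω t < ‖curl (drift g t) x‖ →
        κ * ‖curl (drift g t) x‖ ^ 2 * Laplacian.laplacian (driftP g t) x ≤
          iteratedFDeriv ℝ 2 (driftP g t) x ![curl (drift g t) x, curl (drift g t) x] :=
  n1_blob_of_curl_eq_zero one_pos (driftP g) fun t _ x => n1_curl_drift g t x

/-- **N1, sharp form: the Leray–Hopf clause alone is load-bearing.** K1 with the single
hypothesis `IsLerayHopfOn T ν 0 (u 0) u` deleted (the rapidly decaying datum KEPT) is FALSE: the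
Type-I drift `u = ((1 − t)^{-1/2} − 1)e₀`, `p = −½(1 − t)^{-3/2}x₀` at `ν = T = 1` is classical on
`[0, 1) × ℝ³`, starts from the Schwartz datum `0`, satisfies the blob clause (it is irrotational),
and does not extend past `1` (Koch–Nadirashvili–Seregin–Šverák, Acta Math. 203 (2009), §1 p. 3,
parasitic solutions `u = b(t)`, `p = −b′(t)·x`). [folklore] -/
theorem n1_falseWithoutLerayHopf :
    ¬ (∀ (ν T : ℝ), 0 < ν → 0 < T →
        ∀ (u : ℝ → EuclideanSpace ℝ (Fin 3) → EuclideanSpace ℝ (Fin 3))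
          (p : ℝ → EuclideanSpace ℝ (Fin 3) → ℝ),
        IsClassicalNSSolutionOn (Set.Ico 0 T) ν 0 u p → HasRapidSpatialDecay (u 0) →
        (∃ κ : ℝ, 0 < κ ∧ ∃ Ω : ℝ → ℝ, ∃ t₀ ∈ Set.Ico 0 T, ∀ t ∈ Set.Ico t₀ T,
          (∃ x : EuclideanSpace ℝ (Fin 3), Ω t < ‖curl (u t) x‖) ∧
          ∀ x : EuclideanSpace ℝ (Fin 3), Ω t < ‖curl (u t) x‖ →
            κ * ‖curl (u t) x‖ ^ 2 * Laplacian.laplacian (p t) x ≤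
              iteratedFDeriv ℝ 2 (p t) x ![curl (u t) x, curl (u t) x]) →
        HasSmoothExtensionPast ν 0 u T) := fun h =>
  drift_not_hasSmoothExtensionPast (tendsto_abs_gI_atTop 1 one_pos) 1
    (h 1 1 one_pos one_pos (drift (gI 1)) (driftP (gI 1)) (drift_isClassical (gI_contDiffOn 1) 1)
      (drift_rapidDecay (gI_zero 1)) (n1_blob_drift (gI 1)))

/-- **Exactly one clause of K1 fails on the witness.** At every viscosity `ν` (and `T = 1`) the
Type-I drift is a classical solution on `[0, 1) × ℝ³`, its datum `0` is rapidly decaying, it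
satisfies the blob clause, it is NOT Leray–Hopf (its slices for `0 < t < 1` are non-zero constant
fields, of infinite energy), and it has NO smooth extension past `1`. [folklore] -/
theorem n1_driftI_all_but_lerayHopf (ν : ℝ) :
    IsClassicalNSSolutionOn (Set.Ico 0 1) ν 0 (drift (gI 1)) (driftP (gI 1)) ∧
      HasRapidSpatialDecay (drift (gI 1) 0) ∧
      (∃ κ : ℝ, 0 < κ ∧ ∃ Ω : ℝ → ℝ, ∃ t₀ ∈ Set.Ico 0 (1 : ℝ), ∀ t ∈ Set.Ico t₀ 1,
        (∃ x : EuclideanSpace ℝ (Fin 3), Ω t < ‖curl (drift (gI 1) t) x‖) ∧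
        ∀ x : EuclideanSpace ℝ (Fin 3), Ω t < ‖curl (drift (gI 1) t) x‖ →
          κ * ‖curl (drift (gI 1) t) x‖ ^ 2 * Laplacian.laplacian (driftP (gI 1) t) x ≤
            iteratedFDeriv ℝ 2 (driftP (gI 1) t) x
              ![curl (drift (gI 1) t) x, curl (drift (gI 1) t) x]) ∧
      ¬ IsLerayHopfOn 1 ν 0 (drift (gI 1) 0) (drift (gI 1)) ∧
      ¬ HasSmoothExtensionPast ν 0 (drift (gI 1)) 1 :=
  ⟨drift_isClassical (gI_contDiffOn 1) ν, drift_rapidDecay (gI_zero 1), n1_blob_drift (gI 1),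
    not_isLerayHopfOn_driftI one_pos ν,
    drift_not_hasSmoothExtensionPast (tendsto_abs_gI_atTop 1 one_pos) ν⟩

/-- **N1 (registered stub `stub_falseWithoutFiniteEnergy`): the crux `BlobRiccatiClosure` (K1)
with its two finite-energy hypotheses `IsLerayHopfOn T ν 0 (u 0) u`, `HasRapidSpatialDecay (u 0)`
deleted is FALSE.** Witness used: the irrotational, infinite-energy parasitic drift of
Koch–Nadirashvili–Seregin–Šverák (Acta Math. 203 (2009), §1 p. 3), `u(t, x) = ((1 − t)^{-1/2} − 1)e₀`,
`p(t, x) = −½(1 − t)^{-3/2}x₀`, `ν = T = 1` (tree: `RungReynoldsOneNegative.drift (gI 1)`,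
`driftP (gI 1)`): classical on `[0, 1) × ℝ³`, blob clause with `κ = 1`, `Ω ≡ −1`, `t₀ = 0`
(`curl u ≡ 0`, so every point is a peak point and `κ‖ω‖²Δp ≤ D²p(ω, ω)` reads `0 ≤ 0`), and no
classical extension past `1` (`‖u(t, 0)‖ → ∞`). Its slices for `t > 0` are non-zero constant
fields — not in `L²`, so the solution is neither Leray–Hopf nor spatially decaying for `t > 0`
(its datum `u(0) = 0` happens to decay, whence the sharper `n1_falseWithoutLerayHopf`): the
finite-energy hypotheses of K1 are load-bearing, and K1 is not settled by this junk regime.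
[folklore] (IDEATION-r2-k4 N1, crux workfile.) -/
theorem stub_falseWithoutFiniteEnergy : ¬ (∀ (ν T : ℝ), 0 < ν → 0 < T → ∀ (u : ℝ → EuclideanSpace ℝ (Fin 3) → EuclideanSpace ℝ (Fin 3)) (p : ℝ → EuclideanSpace ℝ (Fin 3) → ℝ), IsClassicalNSSolutionOn (Set.Ico 0 T) ν 0 u p → (∃ κ : ℝ, 0 < κ ∧ ∃ Ω : ℝ → ℝ, ∃ t₀ ∈ Set.Ico 0 T, ∀ t ∈ Set.Ico t₀ T, (∃ x : EuclideanSpace ℝ (Fin 3), Ω t < ‖curl (u t) x‖) ∧ ∀ x : EuclideanSpace ℝ (Fin 3), Ω t < ‖curl (u t) x‖ → κ * ‖curl (u t) x‖ ^ 2 * Laplacian.laplacian (p t) x ≤ iteratedFDeriv ℝ 2 (p t) x ![curl (u t) x, curl (u t) x]) → HasSmoothExtensionPast ν 0 u T) :=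
  fun h => n1_falseWithoutLerayHopf fun ν T hν hT u p hcl _ hblob => h ν T hν hT u p hcl hblob

end Summit.NavierStokesRegularity.NavierStokesRegularity.Theorems.BlobRiccatiClosure.TypeIApexLiouville

end
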